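import Summits.SmoothPoincare4.SmoothPoincare4.Theorems.CylinderEntropyCylinderRungTwoParabolicAreaFloor
import Summits.SmoothPoincare4.SmoothPoincare4.Theorems.CylinderEntropyCylinderRungTwoAreaToFloorOfQuantization
import Summits.SmoothPoincare4.SmoothPoincare4.Theorems.CylinderEntropyCylinderRungTwoHeightsConverge
import Summits.SmoothPoincare4.SmoothPoincare4.Theorems.CylinderEntropyCylinderRungTwoKillingFluxDefs
import Literature.Geometry.Riemannian.SphericalCylinderEntropy
import Mathlib.MeasureTheory.Constructions.BorelSpace.Basic
import HarnessLib

/-!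
# Route `CylinderEntropy`, crux `CylinderRungTwo` (stmt-SmoothPoincare4-7631), line `killing-flux`:
# THE LANDED PROFILE OF A WOULD-BE NULL SURVIVOR (registered helper `helper_nullSurvivorProfile`,
# lead c6, wave 3)

The finite-time half of the crux was reshaped (r17) to the OPEN stub `stub_nullSurvivorsDie`: there is
no immortal smooth cylinder flow `IsCylinderMCF P F ν T` of a compact connected cross-section `P` of
`N = S⁴ × ℝ ⊂ ℝ⁶` with `λ_cyl(F_t P) < 2` for all `t ≥ T` whose slices never separate the two ends of
`N`.  This file PACKAGES everything the tree already proves about such a would-be "null survivor", so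
that the residual content of the open stub is visibly integrality in degree `0`:

* (i) AREA SQUEEZE at every time `t ≥ T`:
  `μH⁴(S⁴) ≤ μH⁴(F_t P) < 2 μH⁴(S⁴)` — the lower bound is the PARABOLIC AREA FLOOR
  `helper_volLeAreaAlongCylinderFlow` (unit lower density along the flow + the soft large-scale kernel
  bound; it needs `Nonempty P`, supplied by `ConnectedSpace P`), the upper bound is
  `IsCylinderMCF.measure_range_lt_two_mul` from `λ_cyl < 2`;
* (ii) the HEIGHTS CONVERGE uniformly to a single value `c` — `helper_heightsConverge` (which is
  stated over a Borel measurable structure on the parameter manifold; we equip `P` with `borel P`).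

The separation hypothesis of the open stub is deliberately ABSENT (nothing landed uses it).  The proof
is a pure composition of the three landed inputs (no `sorry`, no definition, no named fact).

References: R. S. Hamilton, *Monotonicity formulas for parabolic flows on manifolds*, Comm. Anal.
Geom. 1 (1993) 127–137, Thm. 4.1; K. Brakke, *The motion of a surface by its mean curvature* (1978),
§3.
-/

noncomputable section

-- the prescribed namespace `Summit.SmoothPoincare4.SmoothPoincare4.…` repeats `SmoothPoincare4`
set_option linter.dupNamespace false

open MeasureTheory Set Filter
open scoped Manifold ContDiff ENNReal NNReal Topology BigOperators

namespace Summit.SmoothPoincare4.SmoothPoincare4.Cruxes.CylinderRungTwo.KillingFlux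

open Literature.Geometry.Riemannian
open Literature.Geometry.Riemannian.SphericalCylinderEntropy

/-- **Registered helper `helper_nullSurvivorProfile` — THE LANDED PROFILE OF A WOULD-BE NULL SURVIVOR.**
Along an immortal smooth cylinder flow `IsCylinderMCF P F ν T` of a compact connected cross-section
with `λ_cyl(F_t P) < 2` for all `t ≥ T`: (i) at every time `t ≥ T` the area is squeezed,
`μH⁴(S⁴) ≤ μH⁴(F_t P) < 2 μH⁴(S⁴)` (parabolic area floor `helper_volLeAreaAlongCylinderFlow` and
`IsCylinderMCF.measure_range_lt_two_mul`); (ii) the heights `(F s x)₅` converge uniformly in `x` to a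
single value `c` as `s → ∞` (`helper_heightsConverge`, run over the Borel structure `borel P`).
[cite: Hamilton1993, Thm. 4.1] -/
theorem helper_nullSurvivorProfile :
    ∀ (P : Type) [TopologicalSpace P] [T2Space P] [SecondCountableTopology P]
      [ChartedSpace (EuclideanSpace ℝ (Fin 4)) P] [IsManifold (𝓡 4) ∞ P] [CompactSpace P] [ConnectedSpace P]
      (F : ℝ → P → EuclideanSpace ℝ (Fin 6)) (ν : ℝ → P → EuclideanSpace ℝ (Fin 6)) (T : ℝ),
      IsCylinderMCF P F ν T →
      (∀ t, T ≤ t → Literature.Geometry.Riemannian.SphericalCylinderEntropy.cylEntropy (Set.range (F t)) < 2) →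
        (∀ t, T ≤ t → μH[4] (Metric.sphere (0 : EuclideanSpace ℝ (Fin 5)) 1) ≤ μH[4] (Set.range (F t)) ∧
            μH[4] (Set.range (F t)) < 2 * μH[4] (Metric.sphere (0 : EuclideanSpace ℝ (Fin 5)) 1)) ∧
        ∃ c : ℝ, ∀ ε : ℝ, 0 < ε → ∃ s₀ : ℝ, T ≤ s₀ ∧ ∀ s, s₀ ≤ s → ∀ x : P, |F s x 5 - c| < ε := by
  intro P _ _ _ _ _ _ _ F ν T hF hthin
  refine ⟨fun t ht => ⟨?_, hF.measure_range_lt_two_mul ht (hthin t ht)⟩, ?_⟩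
  · -- (i, lower): the parabolic area floor; `Nonempty P` from `ConnectedSpace P`
    exact helper_volLeAreaAlongCylinderFlow P F ν T hF t ht
  · -- (ii): heights converge, over the Borel measurable structure of `P`
    letI : MeasurableSpace P := borel P
    haveI : BorelSpace P := ⟨rfl⟩
    exact helper_heightsConverge P F ν T hF hthin

end Summit.SmoothPoincare4.SmoothPoincare4.Cruxes.CylinderRungTwo.KillingFlux

end
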